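import Summits.BirchSwinnertonDyer.BirchSwinnertonDyer.Theorems.SignedLowerHalvesSmallImageLowerHalfBothSignsRttE2NumHeadline
import Mathlib.RingTheory.Ideal.GoingUp
import HarnessLib

/-!
# Route `SignedLowerHalves`, crux L `SmallImageLowerHalfBothSigns` (stmt-BirchSwinnertonDyer-23599), line `rtt_w3` v13 — E2, LEAD:
# `Λ_𝒪 = 𝒪_S⟦T⟧` OVER `Λ = ℤ_p⟦T⟧` FOR THE E2 GLUE — finiteness, torsion of `Λ_𝒪/(a)`, and `λ(Λ_𝒪/(a))` under the analytic identification

WHY (BRIEF-E2 rev 2.1 §2–§5, `Lines/rtt_w3-BRIEF-E2-g8.md`). The E2 glue `charRoad_E2_of_parts` (companion file `…RttCharRoadE2OfParts`)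
reads the E2-tail of `stub_charRoad_ns` off a four-term exact sequence of `Λ_𝒪`-modules, the `±`-Coleman map `Col : 𝒬 ≃ Λ_𝒪` and the
analytic identification `Col(f z) = c · L · ∏ P_v(u_v(1+T)^{f_v})`; the four-term `λ`-algebra (p773570) is over `Λ = ℤ_p⟦T⟧`, so the glue
needs `Λ_𝒪/(Col (f z))` to be a finitely generated torsion `Λ`-module of the right `λ`. This file supplies exactly that, for `𝒪 = padicCoeffIntegers S`
(`[ℚ_p(S):ℚ_p] < ∞`) and the `Λ`-structure of ANY `[Algebra Λ Λ_𝒪]` whose structure map is the tree's coefficientwise `iwasawaToIwasawaO S`: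
* §1 `moduleFinite_iwasawaAlgebraO` (`Λ_𝒪` is finite over `Λ`: generators `C b_i` for a `ℤ_p`-basis `b_i` of `𝒪`),
  `isTorsion_iwasawaAlgebraO_quotient_span_singleton` (`Λ_𝒪/(a)` is `Λ`-torsion for `a ≠ 0`: integrality), `moduleFinite_iwasawaAlgebraO_quotient_span_singleton`;
* §2 `lambdaInvariant_quotient_eq_compHom` (the scalar-tower `λ` = -w3 g19's explicit-`compHom` `λ`: both see only the constants),
  `lambdaInvariant_quotient_span_eq_of_eulerProduct` (`λ(Λ_𝒪/(a)) = [ℚ_p(S):ℚ_p]·(d + Σ p^{v_p(f_v)}·layerLambda(P_v.comp (C u_v * (X+1))))` — g19's headline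
  `SmallImageRttE2Num.lambdaInvariant_quotient_span_eq_of_eulerProduct_iwasawaAlgebraO` p775021 in the glue's currency), `ne_zero_of_eulerProduct` (`a ≠ 0`).

HONEST FRAMING: `--supports` helper, THEOREMS ONLY (no definition, no named fact, no instance, no `sorry`); pure commutative algebra; nothing about any
Selmer group, Coleman map or modular form is asserted; crux L, crux M, E2 and BSD remain OPEN and are proved for NO curve by any of this.
[cite: Washington1997, §7.1, §13.2] [cite: GreenbergVatsal2000, §2 Prop. (2.4), Cor. (2.3)]
-/

set_option linter.dupNamespace false -- D-0017: single-problem summit, the namespace repeats the problem name by design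
set_option autoImplicit false

noncomputable section

open scoped Classical TensorProduct

namespace Summit.BirchSwinnertonDyer.BirchSwinnertonDyer.Theorems.SmallImageRttCharRoad

open PowerSeries Literature.NumberTheory.EllipticCurves Literature.NumberTheory.IwasawaTheory

/-! ## §1. `Λ_𝒪 = 𝒪_S⟦T⟧` over `Λ = ℤ_p⟦T⟧`: finite, and `Λ_𝒪/(a)` is finitely generated torsion -/

section Finite

variable {p : ℕ} [Fact p.Prime] (S : Set (PadicAlgCl p)) [FiniteDimensional ℚ_[p] (padicCoeffField S)]
  [Algebra (IwasawaAlgebra p) (IwasawaAlgebraO S)]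

/-- **`Λ_𝒪 = 𝒪⟦T⟧` is a finitely generated `Λ = ℤ_p⟦T⟧`-module** for `𝒪 = padicCoeffIntegers S`, `[ℚ_p(S):ℚ_p] < ∞`, the
`Λ`-structure coming from any algebra structure whose structure map is the coefficientwise `iwasawaToIwasawaO S`: a `ℤ_p`-basis
`(b_i)` of `𝒪` gives the generators `C b_i` (coefficientwise expansion). [cite: Washington1997, §13.2] [folklore] -/
theorem moduleFinite_iwasawaAlgebraO
    (halg : ∀ r : IwasawaAlgebra p, algebraMap (IwasawaAlgebra p) (IwasawaAlgebraO S) r = iwasawaToIwasawaO S r) :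
    Module.Finite (IwasawaAlgebra p) (IwasawaAlgebraO S) := by
  -- `𝒪` as a `ℤ_p`-algebra through `padicIntToCoeffIntegers`, finite free (transport from the unit ball)
  letI : Algebra ℤ_[p] (padicCoeffIntegers S) := (padicIntToCoeffIntegers S).toAlgebra
  let E := padicCoeffField S
  let eR : padicCoeffIntegers S ≃+* Literature.NumberTheory.Automorphic.PadicIntermediateField.unitBall p E :=
    RingEquiv.subringCongr (padicCoeffIntegers_eq_unitBall S)
  let eL : padicCoeffIntegers S ≃ₗ[ℤ_[p]] Literature.NumberTheory.Automorphic.PadicIntermediateField.unitBall p E :=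
    { eR with
      map_smul' := fun c x ↦ by
        refine Subtype.ext ?_
        change ((eR (c • x) : _) : PadicAlgCl p) = ((c • eR x : _) : PadicAlgCl p)
        rw [Algebra.smul_def, Algebra.smul_def, map_mul, Subring.coe_mul, Subring.coe_mul]
        congr 1 }
  haveI : Module.Finite ℤ_[p] (padicCoeffIntegers S) := Module.Finite.equiv eL.symm
  haveI : Module.Free ℤ_[p] (padicCoeffIntegers S) := Module.Free.of_equiv eL.symm
  let b := Module.Free.chooseBasis ℤ_[p] (padicCoeffIntegers S)
  -- the generators `C (b i)`
  have hspan : Submodule.span (IwasawaAlgebra p)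
      (Set.range fun i ↦ (PowerSeries.C (b i) : IwasawaAlgebraO S)) = ⊤ := by
    rw [eq_top_iff]
    rintro F -
    -- coefficientwise coordinates
    let r : Module.Free.ChooseBasisIndex ℤ_[p] (padicCoeffIntegers S) → IwasawaAlgebra p :=
      fun i ↦ PowerSeries.mk fun k ↦ b.repr (PowerSeries.coeff k F) i
    have hF : F = ∑ i, r i • (PowerSeries.C (b i) : IwasawaAlgebraO S) := by
      refine PowerSeries.ext fun k ↦ ?_
      rw [map_sum]
      have hterm : ∀ i, PowerSeries.coeff k (r i • (PowerSeries.C (b i) : IwasawaAlgebraO S)) =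
          (b.repr (PowerSeries.coeff k F) i) • b i := fun i ↦ by
        rw [Algebra.smul_def, halg, PowerSeries.coeff_mul_C, iwasawaToIwasawaO, PowerSeries.coeff_map,
          PowerSeries.coeff_mk, Algebra.smul_def, RingHom.algebraMap_toAlgebra]
      simp_rw [hterm]
      exact (b.sum_repr (PowerSeries.coeff k F)).symm
    rw [hF]
    exact Submodule.sum_mem _ fun i _ ↦ Submodule.smul_mem _ _ (Submodule.subset_span ⟨i, rfl⟩)
  exact ⟨by rw [← hspan]; exact Submodule.fg_span (Set.finite_range _)⟩

/-- **`Λ_𝒪/(a)` is a torsion `Λ`-module for `a ≠ 0`**: `Λ_𝒪` is finite, hence integral, over `Λ`, so the ideal `(a)` of the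
domain `Λ_𝒪` contains a non-zero element of `Λ` (the constant term of an integral equation of `a`), which kills `Λ_𝒪/(a)`.
[cite: Washington1997, §13.2] [folklore] -/
theorem isTorsion_iwasawaAlgebraO_quotient_span_singleton
    (halg : ∀ r : IwasawaAlgebra p, algebraMap (IwasawaAlgebra p) (IwasawaAlgebraO S) r = iwasawaToIwasawaO S r)
    {a : IwasawaAlgebraO S} (ha : a ≠ 0) :
    Module.IsTorsion (IwasawaAlgebra p) (IwasawaAlgebraO S ⧸ Ideal.span {a}) := by
  haveI := moduleFinite_iwasawaAlgebraO S halg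
  have hint : IsIntegral (IwasawaAlgebra p) a := IsIntegral.of_finite (IwasawaAlgebra p) a
  have hne : (Ideal.span {a}).comap (algebraMap (IwasawaAlgebra p) (IwasawaAlgebraO S)) ≠ ⊥ :=
    Ideal.comap_ne_bot_of_integral_mem ha (Ideal.mem_span_singleton_self a) hint
  obtain ⟨r, hr, hr0⟩ := Submodule.exists_mem_ne_zero_of_ne_bot hne
  intro m
  refine ⟨⟨r, mem_nonZeroDivisors_of_ne_zero hr0⟩, ?_⟩
  obtain ⟨y, rfl⟩ := Ideal.Quotient.mk_surjective m
  change r • Ideal.Quotient.mk (Ideal.span {a}) y = 0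
  rw [← Ideal.Quotient.mk_eq_mk, ← Submodule.Quotient.mk_smul, Ideal.Quotient.mk_eq_mk, Ideal.Quotient.eq_zero_iff_mem,
    Algebra.smul_def]
  exact Ideal.mul_mem_right _ _ (Ideal.mem_comap.mp hr)

/-- `Λ_𝒪/(a)` is a finitely generated `Λ`-module (quotient of the finite `Λ`-module `Λ_𝒪`). [folklore] -/
theorem moduleFinite_iwasawaAlgebraO_quotient_span_singleton
    (halg : ∀ r : IwasawaAlgebra p, algebraMap (IwasawaAlgebra p) (IwasawaAlgebraO S) r = iwasawaToIwasawaO S r)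
    (a : IwasawaAlgebraO S) :
    Module.Finite (IwasawaAlgebra p) (IwasawaAlgebraO S ⧸ Ideal.span {a}) := by
  haveI := moduleFinite_iwasawaAlgebraO S halg
  infer_instance

end Finite

/-! ## §2. `λ(Λ_𝒪/(a)) = [ℚ_p(S):ℚ_p]·D` under the analytic identification (E2-an + E2-num) -/

section Numerics

variable {p : ℕ} [Fact p.Prime] (S : Set (PadicAlgCl p)) [FiniteDimensional ℚ_[p] (padicCoeffField S)]
  [Algebra (IwasawaAlgebra p) (IwasawaAlgebraO S)]

omit [FiniteDimensional ℚ_[p] (padicCoeffField S)] in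
/-- The `λ`-invariant of `Λ_𝒪/I` for the scalar-tower `Λ`-structure (any `[Algebra Λ Λ_𝒪]` with structure map
`iwasawaToIwasawaO S`) equals the one for -w3 g19's explicit structure `Module.compHom _ (mk ∘ PowerSeries.map ι₀)`,
`ι₀ = padicIntToCoeffIntegers S`: both restrict to the same `ℤ_p`-structure on constants, and `λ = dim_{ℚ_p}(ℚ_p ⊗_{ℤ_p} ·)` sees only
that (`SmallImageRttE2Num.lambdaInvariant_eq_finrank_baseChange_of_C_smul`). [cite: Washington1997, §13.2] [folklore] -/
theorem lambdaInvariant_quotient_eq_compHom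
    (halg : ∀ r : IwasawaAlgebra p, algebraMap (IwasawaAlgebra p) (IwasawaAlgebraO S) r = iwasawaToIwasawaO S r)
    (I : Ideal (IwasawaAlgebraO S)) :
    lambdaInvariant p (IwasawaAlgebraO S ⧸ I) =
      @lambdaInvariant p _ (IwasawaAlgebraO S ⧸ I) _
        (Module.compHom (IwasawaAlgebraO S ⧸ I)
          ((Ideal.Quotient.mk I).comp (PowerSeries.map (padicIntToCoeffIntegers S)))) := by
  -- the common `ℤ_p`-structure: constants, through `Λ → Λ_𝒪 → Λ_𝒪/I`
  letI instZ : Module ℤ_[p] (IwasawaAlgebraO S ⧸ I) :=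
    Module.compHom (IwasawaAlgebraO S ⧸ I)
      (((Ideal.Quotient.mk I).comp (iwasawaToIwasawaO S)).comp (PowerSeries.C : ℤ_[p] →+* IwasawaAlgebra p))
  have h1 : lambdaInvariant p (IwasawaAlgebraO S ⧸ I) =
      Module.finrank ℚ_[p] (ℚ_[p] ⊗[ℤ_[p]] (IwasawaAlgebraO S ⧸ I)) :=
    SmallImageRttE2Num.lambdaInvariant_eq_finrank_baseChange_of_C_smul _ fun r m ↦ by
      obtain ⟨y, rfl⟩ := Ideal.Quotient.mk_surjective m
      calc (PowerSeries.C r : IwasawaAlgebra p) • Ideal.Quotient.mk I y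
          = Ideal.Quotient.mk I ((PowerSeries.C r : IwasawaAlgebra p) • y) := by
            rw [← Ideal.Quotient.mk_eq_mk, ← Ideal.Quotient.mk_eq_mk, Submodule.Quotient.mk_smul]
        _ = Ideal.Quotient.mk I (iwasawaToIwasawaO S (PowerSeries.C r)) * Ideal.Quotient.mk I y := by
            rw [Algebra.smul_def, halg, map_mul]
        _ = r • Ideal.Quotient.mk I y := rfl
  have h2 : @lambdaInvariant p _ (IwasawaAlgebraO S ⧸ I) _
        (Module.compHom (IwasawaAlgebraO S ⧸ I)
          ((Ideal.Quotient.mk I).comp (PowerSeries.map (padicIntToCoeffIntegers S)))) =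
      Module.finrank ℚ_[p] (ℚ_[p] ⊗[ℤ_[p]] (IwasawaAlgebraO S ⧸ I)) :=
    @SmallImageRttE2Num.lambdaInvariant_eq_finrank_baseChange_of_C_smul p _ _ _ (Module.compHom _ _) instZ fun _ _ ↦ rfl
  rw [h1, h2]

/-- **`λ(Λ_𝒪/(a)) = [ℚ_p(S):ℚ_p]·(d + Σ_{v∈s} p^{v_p(f_v)}·layerLambda(P_v.comp (C u_v * (X + 1))))`** whenever
`a ∈ Λ_𝒪` reads in `ℚ̄_p⟦T⟧` as `C c · L · ∏_{v∈s} P_v(u_v·(1+T)^{f_v})` (`c ≠ 0`; `L ≠ 0` with leading index `d`; `P_v, u_v, f_v ≠ 0`):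
-w3 g19's E2-num headline on the crux's carriers, for the scalar-tower `Λ`-structure. In E2, `a = Col(f z)` and the identity is
the analytic identification E2-an. [cite: Washington1997, §7.1 Thm. 7.3 and §13.2] [cite: GreenbergVatsal2000, §2 Prop. (2.4) and Cor. (2.3)] -/
theorem lambdaInvariant_quotient_span_eq_of_eulerProduct
    (halg : ∀ r : IwasawaAlgebra p, algebraMap (IwasawaAlgebra p) (IwasawaAlgebraO S) r = iwasawaToIwasawaO S r)
    {ι' : Type*} (s : Finset ι') {c : PadicAlgCl p} (hc : c ≠ 0) {L : PowerSeries (PadicAlgCl p)} (hL : L ≠ 0) {d : ℕ}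
    (hle : ∀ k, ‖coeff k L‖ ≤ ‖coeff d L‖) (hlt : ∀ k, k < d → ‖coeff k L‖ < ‖coeff d L‖)
    (P : ι' → Polynomial (PadicAlgCl p)) (u : ι' → PadicAlgCl p) (fv : ι' → ℤ_[p])
    (hP : ∀ v ∈ s, P v ≠ 0) (hu : ∀ v ∈ s, u v ≠ 0) (hfv : ∀ v ∈ s, fv v ≠ 0) {a : IwasawaAlgebraO S}
    (ha : iwasawaOToPowerSeries S a = C c * L *
      ∏ v ∈ s, Polynomial.aeval (C (u v) * (binomialSeries ℤ_[p] (fv v)).map (algebraMap ℤ_[p] (PadicAlgCl p))) (P v)) :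
    lambdaInvariant p (IwasawaAlgebraO S ⧸ Ideal.span {a}) =
      Module.finrank ℚ_[p] (padicCoeffField S) *
        (d + ∑ v ∈ s, p ^ (fv v).valuation * layerLambda ((P v).comp (Polynomial.C (u v) * (Polynomial.X + 1)))) := by
  rw [lambdaInvariant_quotient_eq_compHom S halg]
  exact SmallImageRttE2Num.lambdaInvariant_quotient_span_eq_of_eulerProduct_iwasawaAlgebraO p S s hc hL hle hlt P u fv hP hu hfv
    (padicIntToCoeffIntegers S) (coe_padicIntToCoeffIntegers S) a ha

omit [FiniteDimensional ℚ_[p] (padicCoeffField S)] [Algebra (IwasawaAlgebra p) (IwasawaAlgebraO S)] in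
/-- Under the same identification `a ≠ 0` (the right-hand side has a leading index, `SmallImageRttE2Num.normLambda_C_mul_mul_prod_aeval`,
with a non-zero leading coefficient). In E2: `Col(f z) ≠ 0`, the input of the injectivity of `f`. [cite: Washington1997, §7.1] -/
theorem ne_zero_of_eulerProduct {ι' : Type*} (s : Finset ι') {c : PadicAlgCl p} (hc : c ≠ 0) {L : PowerSeries (PadicAlgCl p)}
    (hL : L ≠ 0) {d : ℕ} (hle : ∀ k, ‖coeff k L‖ ≤ ‖coeff d L‖) (hlt : ∀ k, k < d → ‖coeff k L‖ < ‖coeff d L‖)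
    (P : ι' → Polynomial (PadicAlgCl p)) (u : ι' → PadicAlgCl p) (fv : ι' → ℤ_[p])
    (hP : ∀ v ∈ s, P v ≠ 0) (hu : ∀ v ∈ s, u v ≠ 0) (hfv : ∀ v ∈ s, fv v ≠ 0) {a : IwasawaAlgebraO S}
    (ha : iwasawaOToPowerSeries S a = C c * L *
      ∏ v ∈ s, Polynomial.aeval (C (u v) * (binomialSeries ℤ_[p] (fv v)).map (algebraMap ℤ_[p] (PadicAlgCl p))) (P v)) :
    a ≠ 0 := by
  intro h0
  obtain ⟨hnorm, -, -⟩ := SmallImageRttE2Num.normLambda_C_mul_mul_prod_aeval (p := p) s hc hL hle hlt P u fv hP hu hfv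
  rw [← ha, h0, map_zero, map_zero, norm_zero] at hnorm
  refine absurd hnorm (ne_of_lt ?_)
  have hLd : coeff d L ≠ 0 := fun h ↦ hL ((SmallImageRttE2Num.eq_zero_iff_coeff_eq_zero_of_normLambda hle).mpr h)
  refine mul_pos (mul_pos (norm_pos_iff.mpr hc) (norm_pos_iff.mpr hLd)) (Finset.prod_pos fun v hv ↦ ?_)
  exact lt_of_le_of_ne (Polynomial.supNorm_nonneg _)
    (Ne.symm ((Polynomial.supNorm_eq_zero_iff _).not.mpr (SmallImageRttE2Num.comp_C_mul_X_add_one_ne_zero (hP v hv) (hu v hv))))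

end Numerics

end Summit.BirchSwinnertonDyer.BirchSwinnertonDyer.Theorems.SmallImageRttCharRoad

end
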